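/-
Copyright (c) 2026. All rights reserved.
Released under Apache 2.0 license as described in the file LICENSE.
Authors: abc-iut cell, prover seat abc-iut-w5-d053 (gen 5; row «C-PUSH» = the `hpush` hypothesis of brick D2 of abc-iut-w5-d144's
COR510iv-SB′ closer spec, abc-iut-L4-lead m139), over abc-iut-f-101's `logObsFamily` / `DiagramChainFamilies`, abc-iut-L4-t5's
`logObsFamilyTS`, and this seat's `plusToTS` (`LogFrobeniusObservablesTSOfPlus.lean`).
-/
import Literature.AnabelianGeometry.AbsoluteAnabelian.LogFrobeniusObservablesTSOfIotaSquare
import Literature.AnabelianGeometry.AbsoluteAnabelian.LogFrobeniusObservablesTSOfPlus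
import HarnessLib

/-!
# [AbsTopIII] Cor 5.5 (iii): the observable `S_log_v` CONTAINS the observable `S_log⊞_v` pushed along `𝒩⊞_v → 𝒩_v`
# (chain map `S_log⊞ → S_log`; hypothesis `hpush` of the Cor 5.10 (iv) s_b′ closer)

S. Mochizuki, *Topics in absolute anabelian geometry III*, J. Math. Sci. Univ. Tokyo 22 (2015) [MochizukiAbsTopIII2015]; locators =
kurims manuscript pages (`paper:url-5493eb38cbb7`): Def 5.4 (vii) p. 128 («ι_{v,ε} … where the latter … is obtained by composing
… with the natural functor 𝒩⊞_v → 𝒩_v»), Cor 5.5 (iii) p. 131 l. 29–62, Cor 5.10 (iv)(b) pp. 147–148.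

## What this file proves (PROOF-ONLY apart from three structural `def`s of the chain map; no Prop fact)

abc-iut-f-101's `logObsFamily v hsq` (the `⊞`-observable `S_log⊞_v`, generated by the moves `LogGen v` with homotopies
`logGenHom`) and abc-iut-L4-t5's `logObsFamilyTS v T hsqTS` (the `TS`-observable `S_log_v`, generated by `LogGenTS v` with
homotopies `logGenHomTS T`) are both chain families (abc-iut-f-101's `DiagramOfCategories.chainFamily`).  The inclusion of graphs
`plusToTS v : Γ⃗(S_log⊞_v) ↪ Γ⃗(S_log_v)` (this seat, p485225) followed by the edge `𝒩⊞_v → 𝒩_v` maps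

* generators to generators (`LogGen.push`: `pre ε ↦ pre ε.toTS`, `post ε ↦ post ε.toTS`), with homotopy `ι⊞_{v,ε} ▷ (𝒩⊞_v → 𝒩_v)`
  (`logGenHomTS_push`, by `TSHomotopies.iota_toTS`),
* moves to moves and chains to chains (`Move.pushTS`, `Chain.pushTS`), with homotopies whiskered by `𝒩⊞_v → 𝒩_v`
  (`Move.pushTS_hom`, `Chain.pushTS_hom`; `HEq` across the identification `𝒟'_[Φγ·fgt] = 𝒟_[γ] ⋙ (𝒩⊞_v → 𝒩_v)`),

hence ★ `logObsFamilyTS_push`: for every boundary pair `(p, q)` of `S_log⊞_v` with source in `D•≤2`, the pushed pair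
`(Φp·[𝒩⊞_v→𝒩_v], Φq·[𝒩⊞_v→𝒩_v])` is a boundary pair of `S_log_v` and its homotopy is `ζ ▷ (𝒩⊞_v → 𝒩_v)` — the hypothesis
`hpush` of brick D2 (abc-iut-w5-d144's binder line 2026-08-27T02:23Z, in the corrected shape of this seat's 02:40Z line: pairs INTO
`𝒩_v`, homotopy whiskered), for EVERY setting, place, `TS`-datum and square hypotheses; ★ `logObsFamilyTS_push_app` is the
componentwise `eqToHom`-sandwich form.

HONEST FRAMING: interface-level bookkeeping; refereed pre-IUT material; nothing here bears on [IUTchIII] Cor. 3.12; no side taken;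
typed ≠ proved.
-/

set_option autoImplicit false

universe u

open CategoryTheory Quiver

namespace Literature.AnabelianGeometry.AbsoluteAnabelian

namespace LogFrobeniusSetting

variable {Vmod : Type u} {isArc : Vmod → Bool} (L : LogFrobeniusSetting Vmod isArc) (v : Vmod) (T : L.TSHomotopies)

/-! ## §1. Pushed paths and their path functors -/

/-- The pushed path `Φγ · [𝒩⊞_v → 𝒩_v]` of a path `γ` into `𝒩⊞_v`. [cite: MochizukiAbsTopIII2015, Def 5.4 (vii) p. 128] -/
@[reducible] def pushPath {c : (logShapePlus (isArc := isArc) v).Vertex} (γ : Path c (logShapePlus (isArc := isArc) v).obs) :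
    Path ((plusToTS v).obj c) (logShapeTS (isArc := isArc) v).obs :=
  ((plusToTS v).mapPath γ).cons (forgetEdgeTS v)

/-- `Φ(r·g)·fgt = Φr · (Φg·fgt)`. [cite: MochizukiAbsTopIII2015, Def 5.4 (vii) p. 128] -/
theorem pushPath_comp {a c : (logShapePlus (isArc := isArc) v).Vertex} (r : Path a c)
    (g : Path c (logShapePlus (isArc := isArc) v).obs) :
    pushPath v (r.comp g) = ((plusToTS v).mapPath r).comp (pushPath v g) := by
  rw [pushPath, Prefunctor.mapPath_comp]
  rfl

/-- Along the inclusion the path functors between BASE vertices agree (non-structural path functors).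
[cite: MochizukiAbsTopIII2015, Definition 3.5 (i) pp.74–75] -/
theorem pathFunctor_plusToTS_base (x y : DSub (DVertex.InFirstRows (isArc := isArc) 2))
    (r : Path ((logShapePlus (isArc := isArc) v).base x) ((logShapePlus (isArc := isArc) v).base y)) :
    (L.logDiagramTS v).pathFunctor ((plusToTS v).mapPath r) = (L.logDiagramPlus v).pathFunctor r :=
  (((L.logDiagramTS v).pathFunctor_eq_pathFunctor' _).trans (eq_of_heq (L.pathFunctor'_plusToTS_heq v x r))).trans
    ((L.logDiagramPlus v).pathFunctor_eq_pathFunctor' r).symm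

/-- Composition of `HEq`-related morphisms between equal objects. [cite: MochizukiAbsTopIII2015, Definition 3.5 (ii) p.75] -/
theorem comp_heq_of_heq {C : Type*} [Category C] {X Y Z X' Y' Z' : C} (hX : X = X') (hY : Y = Y') (hZ : Z = Z')
    {f : X ⟶ Y} {g : Y ⟶ Z} {f' : X' ⟶ Y'} {g' : Y' ⟶ Z'} (hf : HEq f f') (hg : HEq g g') : HEq (f ≫ g) (f' ≫ g') := by
  subst hX hY hZ; cases eq_of_heq hf; cases eq_of_heq hg; rfl

/-- Components of `HEq`-related natural transformations between equal functors: an `eqToHom` sandwich.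
[cite: MochizukiAbsTopIII2015, Definition 3.5 (ii) p.75] -/
theorem natTrans_app_eq_of_heq {A B : Type*} [Category A] [Category B] {F G F' G' : A ⥤ B} (hF : F = F') (hG : G = G')
    {α : F ⟶ G} {β : F' ⟶ G'} (h : HEq α β) (X : A) :
    α.app X = eqToHom (Functor.congr_obj hF X) ≫ β.app X ≫ eqToHom (Functor.congr_obj hG X).symm := by
  subst hF hG; cases eq_of_heq h; simp

/-! ## §2. Generators to generators -/

/-- **The pushed generator**: `pre ε ↦ pre ε.toTS`, `post ε ↦ post ε.toTS` (the printed pairs of `S_log⊞_v` followed by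
`𝒩⊞_v → 𝒩_v` ARE printed pairs of `S_log_v`). [cite: MochizukiAbsTopIII2015, Cor 5.5 (iii) p. 131] -/
def LogGen.push : ∀ {c : (logShapePlus (isArc := isArc) v).Vertex} {g g' : Path c (logShapePlus (isArc := isArc) v).obs},
    LogGen v g g' → LogGenTS v (pushPath v g) (pushPath v g')
  | _, _, _, LogGen.pre ν₁ ν₂ ε h₁ h₂ => LogGenTS.pre ν₁ ν₂ ε.toTS h₁ h₂
  | _, _, _, LogGen.post ν₁ ν₂ ε h₁ h₂ hsl n => LogGenTS.post ν₁ ν₂ ε.toTS h₁ h₂ hsl n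

/-- **The homotopy of a pushed generator is `ι⊞_{v,ε} ▷ (𝒩⊞_v → 𝒩_v)`** (`TSHomotopies.iota_toTS`), up to the canonical
identifications of path functors. [cite: MochizukiAbsTopIII2015, Def 5.4 (vii) p. 128] -/
theorem logGenHomTS_push {c : (logShapePlus (isArc := isArc) v).Vertex}
    {g g' : Path c (logShapePlus (isArc := isArc) v).obs} (s : LogGen v g g') :
    HEq (L.logGenHomTS v T (LogGen.push v s)) (Functor.whiskerRight (L.logGenHom v s) (L.forget v)) := by
  cases s with
  | pre ν₁ ν₂ ε h₁ h₂ =>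
    change HEq (eqToHom _ ≫ T.iota v ε.toTS ≫ eqToHom _)
      (Functor.whiskerRight (eqToHom _ ≫ L.iota v ε ≫ eqToHom _) (L.forget v))
    rw [T.iota_toTS v ε]
    refine (heq_of_eqToHom_conj _ _ _).trans ?_
    exact whiskerRight_heq_of_heq (L.pathFunctor_lamPath v ν₁ h₁).symm (L.pathFunctor_lamPath' v ν₂ h₂)
      (heq_of_eqToHom_conj _ _ _).symm (L.forget v)
  | post ν₁ ν₂ ε h₁ h₂ hsl n =>
    change HEq (eqToHom _ ≫ T.iota v ε.toTS ≫ eqToHom _)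
      (Functor.whiskerRight (eqToHom _ ≫ L.iota v ε ≫ eqToHom _) (L.forget v))
    rw [T.iota_toTS v ε]
    refine (heq_of_eqToHom_conj _ _ _).trans ?_
    exact whiskerRight_heq_of_heq (L.pathFunctor_postLogDomPath v ν₁ h₁ n hsl).symm (L.pathFunctor_postLogCodPath v n ν₂ h₂)
      (heq_of_eqToHom_conj _ _ _).symm (L.forget v)

/-- A generator pair of `S_log⊞_v` starts at a BASE vertex (`□` or `𝒳_{⋎+1}`). [cite: MochizukiAbsTopIII2015, Cor 5.5 (iii) p. 131] -/
theorem LogGen.exists_eq_base {c : (logShapePlus (isArc := isArc) v).Vertex}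
    {g g' : Path c (logShapePlus (isArc := isArc) v).obs} (s : LogGen v g g') :
    ∃ x : DSub (DVertex.InFirstRows (isArc := isArc) 2), c = (logShapePlus v).base x := by
  cases s with
  | pre => exact ⟨_, rfl⟩
  | post => exact ⟨_, rfl⟩

/-! ## §3. Moves to moves, chains to chains -/

/-- **The pushed move**: prefix `Φr`, generator pushed. [cite: MochizukiAbsTopIII2015, Section 0 p.26] -/
def Move.pushTS {a : (logShapePlus (isArc := isArc) v).Vertex} {p p' : Path a (logShapePlus (isArc := isArc) v).obs}
    (m : DiagramOfCategories.Move (LogGen v) p p') :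
    DiagramOfCategories.Move (LogGenTS v) (pushPath v p) (pushPath v p') :=
  ⟨(plusToTS v).obj m.c, (plusToTS v).mapPath m.r, pushPath v m.g, pushPath v m.g', LogGen.push v m.s,
    (congrArg (pushPath v) m.hp).trans (pushPath_comp v m.r m.g),
    (congrArg (pushPath v) m.hp').trans (pushPath_comp v m.r m.g')⟩

/-- The pushed chain, `nil` case. [cite: MochizukiAbsTopIII2015, Section 0 p.26] -/
theorem Move.pushTS_s {a : (logShapePlus (isArc := isArc) v).Vertex} {p p' : Path a (logShapePlus (isArc := isArc) v).obs}
    (m : DiagramOfCategories.Move (LogGen v) p p') : (Move.pushTS v m).s = LogGen.push v m.s := rfl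

/-- **The pushed chain.** [cite: MochizukiAbsTopIII2015, Section 0 p.26] -/
def Chain.pushTS {a : (logShapePlus (isArc := isArc) v).Vertex} :
    ∀ {p q : Path a (logShapePlus (isArc := isArc) v).obs},
      DiagramOfCategories.Chain (LogGen v) p q → DiagramOfCategories.Chain (LogGenTS v) (pushPath v p) (pushPath v q)
  | _, _, DiagramOfCategories.Chain.nil p => DiagramOfCategories.Chain.nil _
  | _, _, DiagramOfCategories.Chain.cons m rest => DiagramOfCategories.Chain.cons (Move.pushTS v m) (Chain.pushTS rest)

/-- `pushTS` on the empty chain. [cite: MochizukiAbsTopIII2015, Section 0 p.26] -/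
theorem Chain.pushTS_nil {a : (logShapePlus (isArc := isArc) v).Vertex} (p : Path a (logShapePlus (isArc := isArc) v).obs) :
    Chain.pushTS v (DiagramOfCategories.Chain.nil (Gen := LogGen v) p) = DiagramOfCategories.Chain.nil _ := by
  rw [Chain.pushTS]

/-- `pushTS` on a chain with a first move. [cite: MochizukiAbsTopIII2015, Section 0 p.26] -/
theorem Chain.pushTS_cons {a : (logShapePlus (isArc := isArc) v).Vertex} {p p' q : Path a (logShapePlus (isArc := isArc) v).obs}
    (m : DiagramOfCategories.Move (LogGen v) p p') (rest : DiagramOfCategories.Chain (LogGen v) p' q) :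
    Chain.pushTS v (DiagramOfCategories.Chain.cons m rest) =
      DiagramOfCategories.Chain.cons (Move.pushTS v m) (Chain.pushTS v rest) := by
  rw [Chain.pushTS]

/-- **The homotopy of a pushed move is the move's homotopy whiskered by `𝒩⊞_v → 𝒩_v`** (up to the identification of path
functors `𝒟'_[Φγ·fgt] = 𝒟_[γ] ⋙ (𝒩⊞_v → 𝒩_v)`). [cite: MochizukiAbsTopIII2015, Definition 3.5 (ii) p.75] -/
theorem Move.pushTS_hom {x : DSub (DVertex.InFirstRows (isArc := isArc) 2)}
    {p p' : Path ((logShapePlus (isArc := isArc) v).base x) (logShapePlus (isArc := isArc) v).obs}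
    (m : DiagramOfCategories.Move (LogGen v) p p') :
    HEq ((Move.pushTS v m).hom (L.logGenHomTS v T)) (Functor.whiskerRight (m.hom (L.logGenHom v)) (L.forget v)) := by
  obtain ⟨c, r, g, g', s, hp, hp'⟩ := m
  subst hp hp'
  obtain ⟨y, rfl⟩ := LogGen.exists_eq_base v s
  -- both sides are `eqToHom`-conjugates of `𝒟_[r] ◁ (genHom ▷ forget)`
  change HEq (eqToHom _ ≫ Functor.whiskerLeft _ (L.logGenHomTS v T (LogGen.push v s)) ≫ eqToHom _)
    (Functor.whiskerRight (eqToHom _ ≫ Functor.whiskerLeft _ (L.logGenHom v s) ≫ eqToHom _) (L.forget v))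
  refine (heq_of_eqToHom_conj _ _ _).trans ?_
  refine (whiskerLeft_heq_of_eq (L.pathFunctor_plusToTS_base v x y r) (L.pathFunctor_push_eq y g)
    (L.pathFunctor_push_eq y g') (L.logGenHomTS_push v T s)).trans ?_
  have hRL : Functor.whiskerLeft ((L.logDiagramPlus v).pathFunctor r) (Functor.whiskerRight (L.logGenHom v s) (L.forget v)) =
      Functor.whiskerRight (Functor.whiskerLeft ((L.logDiagramPlus v).pathFunctor r) (L.logGenHom v s)) (L.forget v) := rfl
  refine (heq_of_eq hRL).trans ?_
  exact whiskerRight_heq_of_heq ((L.logDiagramPlus v).pathFunctor_comp r g).symm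
    ((L.logDiagramPlus v).pathFunctor_comp r g').symm (heq_of_eqToHom_conj _ _ _).symm (L.forget v)

/-- **The homotopy of a pushed chain is the chain's homotopy whiskered by `𝒩⊞_v → 𝒩_v`.**
[cite: MochizukiAbsTopIII2015, Definition 3.5 (ii) p.75] -/
theorem Chain.pushTS_hom {x : DSub (DVertex.InFirstRows (isArc := isArc) 2)} :
    ∀ {p q : Path ((logShapePlus (isArc := isArc) v).base x) (logShapePlus (isArc := isArc) v).obs}
      (ch : DiagramOfCategories.Chain (LogGen v) p q),
      HEq ((Chain.pushTS v ch).hom (L.logGenHomTS v T)) (Functor.whiskerRight (ch.hom (L.logGenHom v)) (L.forget v))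
  | _, _, DiagramOfCategories.Chain.nil p => by
    rw [Chain.pushTS_nil, DiagramOfCategories.Chain.hom_nil, DiagramOfCategories.Chain.hom_nil, Functor.whiskerRight_id',
      L.pathFunctor_push_eq x p]
    exact HEq.rfl
  | _, _, DiagramOfCategories.Chain.cons m rest => by
    rw [Chain.pushTS_cons, DiagramOfCategories.Chain.hom_cons, DiagramOfCategories.Chain.hom_cons, Functor.whiskerRight_comp]
    exact comp_heq_of_heq (L.pathFunctor_push_eq x _) (L.pathFunctor_push_eq x _) (L.pathFunctor_push_eq x _)
      (Move.pushTS_hom L v T m) (Chain.pushTS_hom rest)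

/-! ## §4. `S_log_v ⊇ S_log⊞_v ▷ (𝒩⊞_v → 𝒩_v)` -/

/-- ★ **`hpush`**: for every boundary pair `(p, q)` of abc-iut-f-101's `S_log⊞_v = logObsFamily v hsq` with source in `D•≤2`,
the pushed pair `(Φp·[𝒩⊞_v→𝒩_v], Φq·[𝒩⊞_v→𝒩_v])` is a boundary pair of abc-iut-L4-t5's `S_log_v = logObsFamilyTS v T hsqTS`, with
homotopy `ζ ▷ (𝒩⊞_v → 𝒩_v)` — for EVERY setting, place, `TS`-datum and square hypotheses.
[cite: MochizukiAbsTopIII2015, Cor 5.5 (iii) p. 131] -/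
theorem logObsFamilyTS_push (hsq : L.IotaSquaresCommute v) (hsqTS : L.IotaSquaresCommuteTS T v)
    {x : DSub (DVertex.InFirstRows (isArc := isArc) 2)}
    (p q : Path ((logShapePlus (isArc := isArc) v).base x) (logShapePlus (isArc := isArc) v).obs)
    (h : (L.logObsFamily v hsq).E p q) :
    ∃ h' : (L.logObsFamilyTS v T hsqTS).E (((plusToTS v).mapPath p).cons (forgetEdgeTS v))
        (((plusToTS v).mapPath q).cons (forgetEdgeTS v)),
      HEq ((L.logObsFamilyTS v T hsqTS).η h') (Functor.whiskerRight ((L.logObsFamily v hsq).η h) (L.forget v)) := by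
  let ch : DiagramOfCategories.Chain (LogGen v) p q := h.2.some
  have h' : (L.logObsFamilyTS v T hsqTS).E (pushPath v p) (pushPath v q) :=
    DiagramOfCategories.chainFamily_mem _ _ _ _ _ _ (Chain.pushTS v ch)
  refine ⟨h', ?_⟩
  have e₁ : (L.logObsFamilyTS v T hsqTS).η h' = (Chain.pushTS v ch).hom (L.logGenHomTS v T) :=
    DiagramOfCategories.chainFamily_η _ _ _ _ _ _ h' _
  have e₂ : (L.logObsFamily v hsq).η h = ch.hom (L.logGenHom v) :=
    DiagramOfCategories.chainFamily_η _ _ _ _ _ _ h _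
  rw [e₁, e₂]
  exact Chain.pushTS_hom L v T ch

/-- ★ Componentwise `eqToHom`-sandwich form of `hpush` (for consumers comparing components at an object `X₀`).
[cite: MochizukiAbsTopIII2015, Cor 5.5 (iii) p. 131] -/
theorem logObsFamilyTS_push_app (hsq : L.IotaSquaresCommute v) (hsqTS : L.IotaSquaresCommuteTS T v)
    {x : DSub (DVertex.InFirstRows (isArc := isArc) 2)}
    (p q : Path ((logShapePlus (isArc := isArc) v).base x) (logShapePlus (isArc := isArc) v).obs)
    (h : (L.logObsFamily v hsq).E p q) (X₀ : (L.logDiagramPlus v).obj ((logShapePlus (isArc := isArc) v).base x)) :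
    ∃ h' : (L.logObsFamilyTS v T hsqTS).E (((plusToTS v).mapPath p).cons (forgetEdgeTS v))
        (((plusToTS v).mapPath q).cons (forgetEdgeTS v)),
      ((L.logObsFamilyTS v T hsqTS).η h').app X₀ =
        eqToHom (Functor.congr_obj (L.pathFunctor_push_eq x p) X₀) ≫
          (L.forget v).map (((L.logObsFamily v hsq).η h).app X₀) ≫
          eqToHom (Functor.congr_obj (L.pathFunctor_push_eq x q) X₀).symm := by
  obtain ⟨h', hη⟩ := L.logObsFamilyTS_push v T hsq hsqTS p q h
  exact ⟨h', natTrans_app_eq_of_heq (L.pathFunctor_push_eq x p) (L.pathFunctor_push_eq x q) hη X₀⟩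

end LogFrobeniusSetting

end Literature.AnabelianGeometry.AbsoluteAnabelian
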